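import Summits.RiemannHypothesis.RiemannHypothesis.Theses.SignCone
import Summits.RiemannHypothesis.RiemannHypothesis.Theorems.SignConeSignConeOscillatoryCoherentCoreCollapse
import Summits.RiemannHypothesis.RiemannHypothesis.Theorems.SignConeSignConeOscillatoryThreshold
import Summits.RiemannHypothesis.RiemannHypothesis.Theorems.OscCoherentCore.Negative.WithoutNodeNonneg
import Summits.RiemannHypothesis.RiemannHypothesis.Theorems.OscCoherentCore.Negative.WithoutPD

/-!
# Disproof of `OscCoherentCore` (crux stmt-RiemannHypothesis-18013, route `SignCone`) — findings

Crux workfile of the standing disprover (seat `refuter-cdisprove-stmt-RiemannHypothesis-18013-0`, cycle 1,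
2026-08-17). Prose only in docstrings; everything below elaborates against the tree, no `sorry`.

## Verdict of cycle 1: NO KILL POSSIBLE SHORT OF `¬RH`; the class restriction is idle; two load-bearing lemmas LANDED

0. **Status (§0, landed by route seats before this seat opened).** `OscCoherentCore ↔ SignConeOscillatory ↔
   SignConeInequality` (`SignCone.oscCoherentCore_iff_signConeOscillatory`, `…_iff_signConeInequality`,
   Theorems/SignConeSignConeOscillatoryCoherentCoreCollapse.lean) and `RiemannHypothesis → OscCoherentCore`
   (`SignCone.oscCoherentCore_of_riemannHypothesis`). So the core IS the parent crux and the route target, it is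
   RH-implied, and an unconditional `¬OscCoherentCore` would be a disproof of RH (`not_riemannHypothesis_of_not_core`).
   Elaboration audit clean (W.lean rc 0): the item body is `Iff.rfl`-equal to
   `… → -(F 0).re ≤ (weilPolarTerm F + weilArchTerm F).re`, `F = Σᵢ weilConv (gᵢ) (weilReflect (gᵢ))`; no junk operator
   bites (finite Bochner expressions on Weil tests; `Complex.digamma` is Mathlib's).
1. **§A positive-definiteness is load-bearing ON THE CORE CLASS** (LANDED p158778,
   `Theorems/OscCoherentCore/Negative/WithoutPD.lean`): replacing the cone structure by "`F` smooth, compactly supported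
   in `[-2a, 2a]`, hermitian" — keeping the cutoff guard `13/10 < a`, the node signs, the class restriction "not a single
   window", the oscillation and the conclusion verbatim — is FALSE, and stays false with ORIGIN DOMINATION
   `‖F u‖ ≤ Re F(0)` added (`oscCoherentCore_false_without_PD`, `…_false_without_PD_originDominating`). Mechanism: a
   TRANSFER lemma (`withoutPD_originDominating_transfer`: the core-class mutated statement implies the parent's, by
   appending two vanishing two-bumps beyond `supp F` and `η → 0`) + the parent's landed witnesses (plateau comb at
   `a = 11/10`; `-(φ(·-9/10)+φ(·+9/10))` at `a = 1`).
2. **§B node non-negativity is load-bearing ON THE CORE CLASS, and no slack replaces it** (LANDED p158661,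
   `Theorems/OscCoherentCore/Negative/WithoutNodeNonneg.lean`): deleting `∀ n ≥ 2, 0 ≤ Re F(log n)` (all else verbatim)
   is FALSE, and for EVERY `C : ℝ` the hn-free statement with slack `-C·Re F(0)` is false
   (`oscCoherentCore_false_without_nodeNonneg`, `…_anySlack`). Witness `k = 2`, `g = (w_c, η w_{c+4})`: the parent's
   polar-dominating antisymmetric pair `w_c` (`moll 0`, `exists_twoBump_re_weilArchPolar_lt C`) plus a second tiny pair
   at height `c + 4`, so the negativity sits at `c` AND `c + 4 > c + log 2` — in NO single window — for every `η > 0`.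
   (The parent's one-pair witness with a narrow bump is single-window, cf. `OscSingleWindow.Negative.WithoutNodeNonneg`;
   the class restriction of the core costs exactly one more vanishing pair.)
3. **§C NOT load-bearing (idle):** the cutoff guard `13/10 < a` and the class restriction `¬ single window`
   (`oscCoherentCore_iff_withoutGuardAndClass` = the landed collapse: both deleted gives `SignConeOscillatory`, which is
   EQUIVALENT to the core); the oscillation hypothesis (deleting it too gives the target `SignConeInequality`, again
   equivalent); the support hypothesis by itself (content is `a = ∞`); composite nodes MODULO RH
   (`oscCoherentCore_primePowerNodes_of_riemannHypothesis`: under RH the node signs are needed only at prime powers —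
   no `_false_without_compositeNodes` short of `¬RH`); the case `k = 0` (not oscillatory).
4. **§V not vacuous:** the hypotheses of the core are jointly satisfiable at EVERY cutoff `a ≥ 1`, in particular on the
   whole range `a > 13/10` of the item (`oscCoherentCore_hypotheses_satisfiable`: the parent's oscillatory witness at
   cutoff `1` has its negativity below height `2 < 3`).
5. **§S strengthenings / tightness — nothing refutable:** the slack-free ("exact") strengthening `0 ≤ Re W_ar(F)` and every
   intermediate slack are RH-implied as well (`Re W_ar = Re W + Re P_Λ ≥ 0` under RH on the sign cone), so NO tightness
   lemma for the unit constant can exist short of `¬RH` (a node-nonnegative cone element with `Re W_ar(F) < 0` at any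
   cutoff disproves RH — the route's KILL CRITERION); numerically `min Re W_ar/F(0) ≈ +0.02…+0.05` at `a ≤ 2.3` (parent
   §N, kit j020695). Weakening the node set: the parent's LP table says the unit slack absorbs losing node `2`, `{2,3}`,
   all even nodes, even all proper prime powers (`-0.46`), but NOT `{2,3,4,5}` (`-1.005 … -1.014` from `x ≈ 55`) nor
   `n ≤ 7` (`-1.27`) — so "node signs only for `n ≥ 6`" is a false weakening (uncertified: margin `0.005–0.27`, a
   certified primal evaluation of `W_ar` on a B-spline design is ≈ 10³ lines and was not attempted this cycle).
6. **Why it resists (for ideators/provers):** exactly as the parent (Cruxes/SignConeOscillatory/Disproof.lean §5): every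
   attack on TRUTH reduces to `¬RH`; the content sits in the node signs AT PRIME POWERS interacting with
   positive-definiteness (`F̂ ≥ 0`), i.e. a proof must re-derive `P_Λ`-type control of the rank-2 polar form
   `2 Re(ĝ(0) conj ĝ(1))` from the node train. NEW for the core: the three-regime split of `closes` isolates nothing —
   any presence-type sub-class reachable from an arbitrary cone element by appending far vanishing two-bumps (here:
   "negativity not in one window") is the whole target; a split that bites must quantify the DEPTH of the low
   negativity relative to `F(0)` or pin the cutoff to the support (parent IffInequality docstring; strategist census
   §1.D1/D2).
7. **Targets (§T):** none this cycle (payload `targets = []`, `stuck_stubs = []`; no line picked for this crux; the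
   parent's lines `Sketch` / `dual_witness` apply verbatim and were audited by the parent's disprover: no `stub_*_false`).
   Literature negatives: none possible (RH-implied statement); `ledger negatives` for the summit lists no sign-cone item.
-/

noncomputable section

-- `Summit.RiemannHypothesis.RiemannHypothesis.…` repeats a namespace component by design (D-0017 layout).
set_option linter.dupNamespace false

open scoped BigOperators ComplexConjugate ArithmeticFunction.vonMangoldt
open Complex MeasureTheory Set Filter

namespace Summit.RiemannHypothesis.RiemannHypothesis.Cruxes.OscCoherentCore.Disproof

open Literature.NumberTheory.LFunctions
open Summit.RiemannHypothesis.RiemannHypothesis.Theses.SignCone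
open Summit.RiemannHypothesis.RiemannHypothesis.Theorems.SignCone
open Summit.RiemannHypothesis.RiemannHypothesis.Theorems.RuelleBandCofiniteCriticalLine
open Summit.RiemannHypothesis.RiemannHypothesis.Theorems.OscCoherentCore.Negative

/-! ## §0 Status: the core is the crux, the target, and RH-implied (re-exports of landed theorems) -/

/-- `OscCoherentCore ↔ SignConeOscillatory` (landed collapse): the core IS the parent crux. [folklore] -/
theorem core_iff_parent : OscCoherentCore ↔ SignConeOscillatory :=
  oscCoherentCore_iff_signConeOscillatory

/-- `OscCoherentCore ↔ SignConeInequality` (landed): the core IS the route target. [folklore] -/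
theorem core_iff_target : OscCoherentCore ↔ SignConeInequality :=
  oscCoherentCore_iff_signConeInequality

/-- `RH → OscCoherentCore` (landed): the core is RH-implied. [folklore] -/
theorem core_of_riemannHypothesis (hRH : RiemannHypothesis) : OscCoherentCore :=
  oscCoherentCore_of_riemannHypothesis hRH

/-- Kill propagation: a refutation of the core is a disproof of RH. [folklore] -/
theorem not_riemannHypothesis_of_not_core (h : ¬ OscCoherentCore) : ¬ RiemannHypothesis :=
  fun hRH => h (oscCoherentCore_of_riemannHypothesis hRH)

/-! ## §A Load-bearing: positive-definiteness (landed `Negative/WithoutPD.lean`, p158778) -/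

/-- The core with "`F = Σᵢ gᵢ ⋆ g̃ᵢ`, `supp gᵢ ⊆ [-a, a]`" replaced by "`F` smooth, compactly supported in `[-2a, 2a]`,
hermitian"; cutoff guard, node hypothesis, class restriction, oscillation hypothesis and conclusion verbatim.
[folklore] -/
def OscCoherentCoreWithoutPD : Prop :=
  ∀ a : ℝ, 0 < a → 13 / 10 < a → ∀ F : ℝ → ℂ,
    (ContDiff ℝ ((⊤ : ℕ∞) : WithTop ℕ∞) F ∧ HasCompactSupport F) ∧ tsupport F ⊆ Set.Icc (-(2 * a)) (2 * a) →
    (∀ u : ℝ, F (-u) = (starRingEnd ℂ) (F u)) →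
    (∀ n : ℕ, 2 ≤ n → 0 ≤ (F (Real.log n)).re) →
    ¬ (∃ T : ℝ, 3 ≤ T ∧ ∀ t : ℝ, Real.log 2 ≤ |t| → (F t).re < 0 → T ≤ |t| ∧ |t| ≤ T + Real.log 2) →
    (∃ t : ℝ, Real.log 2 ≤ |t| ∧ (F t).re < 0) →
    let M : ℂ → ℂ := fun s => ∫ u : ℝ, F u * Complex.exp ((s - 1 / 2) * u);
    -(F 0).re ≤ (M 0 + M 1 + ((1 / (2 * Real.pi) : ℂ) * (∫ t : ℝ, M (1 / 2 + t * Complex.I) *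
      ((Complex.digamma (1 / 4 + t / 2 * Complex.I)).re : ℂ)) - F 0 * (Real.log Real.pi : ℂ))).re

/-- The same with ORIGIN DOMINATION `‖F u‖ ≤ Re F(0)` added to the hypotheses. [folklore] -/
def OscCoherentCoreWithoutPDOriginDominating : Prop :=
  ∀ a : ℝ, 0 < a → 13 / 10 < a → ∀ F : ℝ → ℂ,
    (ContDiff ℝ ((⊤ : ℕ∞) : WithTop ℕ∞) F ∧ HasCompactSupport F) ∧ tsupport F ⊆ Set.Icc (-(2 * a)) (2 * a) →
    (∀ u : ℝ, F (-u) = (starRingEnd ℂ) (F u)) → (∀ u : ℝ, ‖F u‖ ≤ (F 0).re) →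
    (∀ n : ℕ, 2 ≤ n → 0 ≤ (F (Real.log n)).re) →
    ¬ (∃ T : ℝ, 3 ≤ T ∧ ∀ t : ℝ, Real.log 2 ≤ |t| → (F t).re < 0 → T ≤ |t| ∧ |t| ≤ T + Real.log 2) →
    (∃ t : ℝ, Real.log 2 ≤ |t| ∧ (F t).re < 0) →
    let M : ℂ → ℂ := fun s => ∫ u : ℝ, F u * Complex.exp ((s - 1 / 2) * u);
    -(F 0).re ≤ (M 0 + M 1 + ((1 / (2 * Real.pi) : ℂ) * (∫ t : ℝ, M (1 / 2 + t * Complex.I) *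
      ((Complex.digamma (1 / 4 + t / 2 * Complex.I)).re : ℂ)) - F 0 * (Real.log Real.pi : ℂ))).re

/-- **Any proof must use positive-definiteness** (LANDED p158778): the mutated statement is false. [folklore] -/
theorem oscCoherentCore_false_without_PD : ¬ OscCoherentCoreWithoutPD :=
  Summit.RiemannHypothesis.RiemannHypothesis.Theorems.OscCoherentCore.Negative.oscCoherentCore_false_without_PD

/-- **…and origin domination `|F| ≤ F(0)` does not substitute for it** (LANDED p158778). [folklore] -/
theorem oscCoherentCore_false_without_PD_originDominating : ¬ OscCoherentCoreWithoutPDOriginDominating :=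
  Summit.RiemannHypothesis.RiemannHypothesis.Theorems.OscCoherentCore.Negative.oscCoherentCore_false_without_PD_originDominating

/-- The cone statement implies the PD-free statement restricted to cone elements, i.e. the mutation really only
deletes structure: every `F = Σᵢ gᵢ ⋆ g̃ᵢ` with `supp gᵢ ⊆ [-a, a]` is smooth, compactly supported in `[-2a, 2a]` and
hermitian, so `OscCoherentCoreWithoutPD → OscCoherentCore`. [folklore] -/
theorem core_of_withoutPD (h : OscCoherentCoreWithoutPD) : OscCoherentCore := by
  intro a ha ha13 k g hg F hn hnw hosc
  have hFdef : F = fun t => ∑ i, weilConv (g i) (weilReflect (g i)) t := rfl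
  have hgi : ∀ i, IsWeilTest (g i) := fun i => (hg i).1
  have hFt : IsWeilTest F := by
    rw [hFdef]
    exact stub_branchesContinuous_isWeilTest_sum _ fun i _ => (hgi i).weilConv (hgi i).weilReflect
  have hsupp : tsupport F ⊆ Set.Icc (-(2 * a)) (2 * a) := by
    rw [hFdef]
    refine closure_minimal (fun u hu => ?_) isClosed_Icc
    rw [Function.mem_support] at hu
    by_contra hu'
    refine hu (Finset.sum_eq_zero fun i _ => ?_)
    refine image_eq_zero_of_notMem_tsupport fun hmem => hu' ?_
    exact tsupport_weilConv_weilReflect_subset (hgi i).2 (hg i).2 hmem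
  have hherm : ∀ u : ℝ, F (-u) = (starRingEnd ℂ) (F u) := by
    intro u
    simp only [hFdef, map_sum, weilConv_weilReflect_neg]
  exact h a ha ha13 F ⟨hFt, hsupp⟩ hherm hn hnw hosc

/-! ## §B Load-bearing: node non-negativity (landed `Negative/WithoutNodeNonneg.lean`, p158661) -/

/-- The core with the node hypothesis `∀ n ≥ 2, 0 ≤ Re F(log n)` deleted; everything else verbatim. [folklore] -/
def OscCoherentCoreWithoutNodeNonneg : Prop :=
  ∀ a : ℝ, 0 < a → 13 / 10 < a → ∀ (k : ℕ) (g : Fin k → ℝ → ℂ), (∀ i, (ContDiff ℝ ((⊤ : ℕ∞) : WithTop ℕ∞) (g i) ∧ HasCompactSupport (g i)) ∧ tsupport (g i) ⊆ Set.Icc (-a) a) → let F : ℝ → ℂ := fun t => ∑ i, MeasureTheory.convolution (g i) (fun u => (starRingEnd ℂ) ((g i) (-u))) (ContinuousLinearMap.mul ℂ ℂ) MeasureTheory.MeasureSpace.volume t; ¬ (∃ T : ℝ, 3 ≤ T ∧ ∀ t : ℝ, Real.log 2 ≤ |t| → (F t).re < 0 → T ≤ |t| ∧ |t| ≤ T +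 Real.log 2) → (∃ t : ℝ, Real.log 2 ≤ |t| ∧ (F t).re < 0) → let M : ℂ → ℂ := fun s => ∫ u : ℝ, F u * Complex.exp ((s - 1 / 2) * u); -(F 0).re ≤ (M 0 + M 1 + ((1 / (2 * Real.pi) : ℂ) * (∫ t : ℝ, M (1 / 2 + t * Complex.I) * ((Complex.digamma (1 / 4 + t / 2 * Complex.I)).re : ℂ)) - F 0 * (Real.log Real.pi : ℂ))).re

/-- **Any proof must use the node signs** (LANDED p158661): witness `g = (w_c, η w_{c+4})`, `η → 0`. [folklore] -/
theorem oscCoherentCore_false_without_nodeNonneg : ¬ OscCoherentCoreWithoutNodeNonneg :=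
  Summit.RiemannHypothesis.RiemannHypothesis.Theorems.OscCoherentCore.Negative.oscCoherentCore_false_without_nodeNonneg

/-- **…and no constant slack rescues it** (LANDED p158661): for every `C : ℝ` the hn-free core statement with
conclusion `-C·Re F(0) ≤ Re W_ar(F)` is false — "weaken the slack" is not a repair. [folklore] -/
theorem oscCoherentCore_false_without_nodeNonneg_anySlack (C : ℝ) :
    ¬ (∀ a : ℝ, 0 < a → 13 / 10 < a → ∀ (k : ℕ) (g : Fin k → ℝ → ℂ), (∀ i, (ContDiff ℝ ((⊤ : ℕ∞) : WithTop ℕ∞) (g i) ∧ HasCompactSupport (g i)) ∧ tsupport (g i) ⊆ Set.Icc (-a) a) → let F : ℝ → ℂ := fun t => ∑ i, MeasureTheory.convolution (g i) (fun u => (starRingEnd ℂ) ((g i) (-u))) (ContinuousLinearMap.mul ℂ ℂ) MeasureTheory.MeasureSpace.volume t; ¬ (∃ T : ℝ, 3 ≤ T ∧ ∀ t : ℝ, Real.log 2 ≤ |t| → (F t).re < 0 → T ≤ |t| ∧ |t| ≤ T + Real.log 2) → (∃ t : ℝ, Real.log 2 ≤ |t| ∧ (F t).re < 0) → let M : ℂ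 → ℂ := fun s => ∫ u : ℝ, F u * Complex.exp ((s - 1 / 2) * u); -(C * (F 0).re) ≤ (M 0 + M 1 + ((1 / (2 * Real.pi) : ℂ) * (∫ t : ℝ, M (1 / 2 + t * Complex.I) * ((Complex.digamma (1 / 4 + t / 2 * Complex.I)).re : ℂ)) - F 0 * (Real.log Real.pi : ℂ))).re) :=
  Summit.RiemannHypothesis.RiemannHypothesis.Theorems.OscCoherentCore.Negative.oscCoherentCore_false_without_nodeNonneg_anySlack C

/-- The deleted hypothesis really is the only difference: `OscCoherentCoreWithoutNodeNonneg → OscCoherentCore`.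
[folklore] -/
theorem core_of_withoutNodeNonneg (h : OscCoherentCoreWithoutNodeNonneg) : OscCoherentCore :=
  fun a ha ha13 k g hg _hn hnw hosc => h a ha ha13 k g hg hnw hosc

/-! ## §C Not load-bearing (idle hypotheses) -/

/-- **The cutoff guard `13/10 < a` and the class restriction "not a single window" are idle**: deleting BOTH gives
the parent crux `SignConeOscillatory`, which is EQUIVALENT to the core (landed collapse). So no `_false_without_guard`
/ `_false_without_class` exists short of `¬RH`. [folklore] -/
theorem withoutGuardAndClass_iff : SignConeOscillatory ↔ OscCoherentCore :=
  oscCoherentCore_iff_signConeOscillatory.symm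

/-- **The oscillation hypothesis is idle too**: deleting guard, class restriction AND oscillation gives the route
target `SignConeInequality`, again equivalent to the core. [folklore] -/
theorem withoutOsc_iff : SignConeInequality ↔ OscCoherentCore :=
  oscCoherentCore_iff_signConeInequality.symm

/-- **The core implies its sibling** `OscSingleWindow` (landed): in `closes hR hS hC …` the hypotheses `hR`, `hS` are
implied by `hC`. [folklore] -/
theorem single_of_core (h : OscCoherentCore) : OscSingleWindow :=
  oscSingleWindow_of_oscCoherentCore h

/-- The prime term needs the node signs only where `Λ(n) ≠ 0`: on a hermitian compactly supported kernel with
`Re F(log n) ≥ 0` at PRIME POWERS, `Re P_Λ(F) ≥ 0` (parent Disproof §C, re-proved here to stay import-free).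
[folklore] -/
theorem re_weilPrimeTerm_nonneg_of_primePowerNodes {F : ℝ → ℂ} (hFc : HasCompactSupport F)
    (hsym : ∀ t : ℝ, conj (F (-t)) = F t)
    (hn : ∀ n : ℕ, 2 ≤ n → IsPrimePow n → 0 ≤ (F (Real.log n)).re) :
    0 ≤ (weilPrimeTerm F).re := by
  unfold weilPrimeTerm
  rw [Complex.re_tsum (summable_weilPrimeTerm hFc)]
  refine tsum_nonneg fun n => ?_
  have hcoef : ((Λ n : ℝ) : ℂ) / (Real.sqrt n : ℂ) = ((Λ n / Real.sqrt n : ℝ) : ℂ) := by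
    push_cast
    rfl
  by_cases hpp : IsPrimePow n
  · have hn2 : 2 ≤ n := hpp.two_le
    have hre' : (F (-Real.log n)).re = (F (Real.log n)).re := by
      have h := congrArg Complex.re (hsym (Real.log n))
      simpa only [Complex.conj_re] using h
    have hre : (F (Real.log n) + F (-Real.log n)).re = 2 * (F (Real.log n)).re := by
      rw [Complex.add_re, hre']
      ring
    rw [hcoef, Complex.re_ofReal_mul, hre]
    exact mul_nonneg (div_nonneg ArithmeticFunction.vonMangoldt_nonneg (Real.sqrt_nonneg _))
      (by nlinarith [hn n hn2 hpp])
  · have hΛ : Λ n = 0 := ArithmeticFunction.vonMangoldt_eq_zero_iff.2 hpp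
    simp [hΛ]

/-- **Composite nodes are not load-bearing modulo RH**: under `RiemannHypothesis` the core holds with the node
hypothesis restricted to prime powers `n = p^k` (everything else verbatim). Hence no `_false_without_compositeNodes`
can exist short of `¬RH` (unconditionally this is the 2001 rigidity `K ⊆ {Λ}`). [folklore] -/
theorem oscCoherentCore_primePowerNodes_of_riemannHypothesis (hRH : RiemannHypothesis) :
    ∀ a : ℝ, 0 < a → 13 / 10 < a → ∀ (k : ℕ) (g : Fin k → ℝ → ℂ), (∀ i, (ContDiff ℝ ((⊤ : ℕ∞) : WithTop ℕ∞) (g i) ∧ HasCompactSupport (g i)) ∧ tsupport (g i) ⊆ Set.Icc (-a) a) → let F : ℝ → ℂ := fun t => ∑ i, MeasureTheory.convolution (g i) (fun u => (starRingEnd ℂ) ((g i) (-u))) (ContinuousLinearMap.mul ℂ ℂ) MeasureTheory.MeasureSpace.volume t; (∀ n : ℕ, 2 ≤ n → IsPrimePow n → 0 ≤ (F (Real.log n)).re) → ¬ (∃ T : ℝ, 3 ≤ T ∧ ∀ t : ℝ, Real.log 2 ≤ |t| → (F t).re < 0 → T ≤ |t| ∧ |t| ≤ T + Real.log 2) → (∃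 t : ℝ, Real.log 2 ≤ |t| ∧ (F t).re < 0) → let M : ℂ → ℂ := fun s => ∫ u : ℝ, F u * Complex.exp ((s - 1 / 2) * u); -(F 0).re ≤ (M 0 + M 1 + ((1 / (2 * Real.pi) : ℂ) * (∫ t : ℝ, M (1 / 2 + t * Complex.I) * ((Complex.digamma (1 / 4 + t / 2 * Complex.I)).re : ℂ)) - F 0 * (Real.log Real.pi : ℂ))).re := by
  intro a _ha _ha13 k g hg F hn _hnw _hosc
  show -(F 0).re ≤ (weilPolarTerm F + weilArchTerm F).re
  have hF : F = fun t => ∑ i, weilConv (g i) (weilReflect (g i)) t := rfl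
  have hgi : ∀ i, IsWeilTest (g i) := fun i => (hg i).1
  have hGi : ∀ i, IsWeilTest (weilConv (g i) (weilReflect (g i))) := fun i =>
    (hgi i).weilConv (hgi i).weilReflect
  have hFt : IsWeilTest F := by
    rw [hF]
    exact stub_branchesContinuous_isWeilTest_sum _ fun i _ => hGi i
  have hdec : weilPolarTerm F + weilArchTerm F = weilFunctional F + weilPrimeTerm F := by
    unfold weilFunctional
    ring
  have hW : weilFunctional F = ∑ i, weilQuadratic (g i) := by
    rw [hF, stub_branchesContinuous_weilFunctional_sum _ fun i _ => hGi i]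
    rfl
  have hWP : WeilPositivity := WeilPositivity.of_riemannHypothesis explicit_formula_holds hRH
  have hWre : 0 ≤ (weilFunctional F).re := by
    rw [hW, Complex.re_sum]
    exact Finset.sum_nonneg fun i _ => hWP _ (hgi i)
  have hsym : ∀ t : ℝ, conj (F (-t)) = F t := by
    intro t
    simp only [hF, map_sum, conj_weilConv_weilReflect_neg]
  have hPre : 0 ≤ (weilPrimeTerm F).re := re_weilPrimeTerm_nonneg_of_primePowerNodes hFt.2 hsym hn
  have h0 : 0 ≤ (F 0).re := by
    rw [hF]
    simp only [Complex.re_sum, weilConv_weilReflect_apply_zero, Complex.ofReal_re]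
    exact Finset.sum_nonneg fun i _ => integral_nonneg fun t => by positivity
  rw [hdec, Complex.add_re]
  linarith

/-- **The support hypothesis (and with it the cutoff `a`) carries no information by itself**: the core implies
its own version WITHOUT `tsupport (gᵢ) ⊆ [-a, a]` (apply the core, via the target, at a cutoff containing every
support). [folklore] -/
theorem withoutSupport_of_core (h : OscCoherentCore) :
    ∀ (k : ℕ) (g : Fin k → ℝ → ℂ), (∀ i, ContDiff ℝ ((⊤ : ℕ∞) : WithTop ℕ∞) (g i) ∧ HasCompactSupport (g i)) → let F : ℝ → ℂ := fun t => ∑ i, MeasureTheory.convolution (g i) (fun u => (starRingEnd ℂ) ((g i) (-u))) (ContinuousLinearMap.mul ℂ ℂ) MeasureTheory.MeasureSpace.volume t; (∀ n : ℕ, 2 ≤ n → 0 ≤ (F (Real.log n)).re) → let M : ℂ → ℂ := fun s => ∫ u : ℝ, F u * Complex.exp ((s - 1 / 2) * u); -(F 0).re ≤ (M 0 + M 1 + ((1 / (2 * Real.pi) : ℂ) * (∫ t : ℝ, M (1 / 2 + t * Complex.I) * ((Complex.digamma (1 / 4 + t / 2 * Complex.I)).re : ℂ)) - F 0 * (Real.log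 Real.pi : ℂ))).re := by
  intro k g hg F hn
  have hX : SignConeInequality := oscCoherentCore_iff_signConeInequality.1 h
  have hR : ∀ i, ∃ R : ℝ, 0 < R ∧ tsupport (g i) ⊆ Set.Icc (-R) R := by
    intro i
    obtain ⟨r, hr⟩ := (hg i).2.isCompact.isBounded.subset_closedBall 0
    refine ⟨|r| + 1, by positivity, fun y hy => ?_⟩
    have hy' := hr hy
    rw [Metric.mem_closedBall, dist_zero_right, Real.norm_eq_abs] at hy'
    rw [Set.mem_Icc]
    constructor <;> linarith [le_abs_self r, neg_abs_le y, le_abs_self y]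
  choose R hRpos hRsub using hR
  have hsum : ∀ i, R i ≤ ∑ j, R j := fun i =>
    Finset.single_le_sum (fun j _ => (hRpos j).le) (Finset.mem_univ i)
  have ha' : 0 < 1 + ∑ j, R j := by
    have : 0 ≤ ∑ j, R j := Finset.sum_nonneg fun j _ => (hRpos j).le
    linarith
  have hsub : ∀ i, tsupport (g i) ⊆ Set.Icc (-(1 + ∑ j, R j)) (1 + ∑ j, R j) := by
    intro i y hy
    have hy' := hRsub i hy
    rw [Set.mem_Icc] at hy' ⊢
    constructor <;> linarith [hsum i, hy'.1, hy'.2]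
  exact hX (1 + ∑ j, R j) ha' k g (fun i => ⟨hg i, hsub i⟩) hn

/-- The case `k = 0` is vacuous (`F = 0` is not oscillatory), whatever the cutoff. [folklore] -/
theorem not_oscillatory_of_k_eq_zero (g : Fin 0 → ℝ → ℂ) :
    ¬ ∃ t : ℝ, Real.log 2 ≤ |t| ∧
      ((fun t => ∑ i, MeasureTheory.convolution (g i) (fun u => (starRingEnd ℂ) ((g i) (-u)))
        (ContinuousLinearMap.mul ℂ ℂ) MeasureTheory.MeasureSpace.volume t) t).re < 0 := by
  rintro ⟨t, -, ht⟩
  simp at ht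

/-! ## §V Not vacuous: the hypotheses of the core are satisfiable at every cutoff `a ≥ 1` -/

/-- The autocorrelation sum of tests supported in `[-a, a]` vanishes at every `|c| > 2a`. [folklore] -/
theorem sum_weilConv_apply_eq_zero_of_lt_abs {k : ℕ} {g : Fin k → ℝ → ℂ} {a c : ℝ}
    (hg : ∀ i, (ContDiff ℝ ((⊤ : ℕ∞) : WithTop ℕ∞) (g i) ∧ HasCompactSupport (g i)) ∧
      tsupport (g i) ⊆ Set.Icc (-a) a)
    (hc : 2 * a < |c|) : (∑ i, weilConv (g i) (weilReflect (g i)) c) = 0 := by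
  refine Finset.sum_eq_zero fun i _ => ?_
  have hgi : IsWeilTest (g i) := (hg i).1
  have hsub := tsupport_weilConv_weilReflect_subset hgi.2 (hg i).2
  refine image_eq_zero_of_notMem_tsupport fun hmem => ?_
  have := hsub hmem
  rw [mem_Icc] at this
  rcases le_or_gt 0 c with hc0 | hc0
  · rw [abs_of_nonneg hc0] at hc
    linarith [this.2]
  · rw [abs_of_neg hc0] at hc
    linarith [this.1]

/-- **`OscCoherentCore` is not vacuous**: at EVERY cutoff `a ≥ 1` (so on the whole range `a > 13/10` of the item)
the hypotheses — test-function data supported in `[-a, a]`, node non-negativity, "not a single window", far-field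
oscillation — are jointly satisfiable: the parent's oscillatory witness at cutoff `1`
(`SignCone.oscillatoryClass_nonempty_iff`, `(log 2)/2 < 1`) has all its negativity at heights `≤ 2 < 3`. [folklore] -/
theorem oscCoherentCore_hypotheses_satisfiable :
    ∀ a : ℝ, 1 ≤ a → ∃ (k : ℕ) (g : Fin k → ℝ → ℂ), (∀ i, (ContDiff ℝ ((⊤ : ℕ∞) : WithTop ℕ∞) (g i) ∧ HasCompactSupport (g i)) ∧ tsupport (g i) ⊆ Set.Icc (-a) a) ∧ let F : ℝ → ℂ := fun t => ∑ i, MeasureTheory.convolution (g i) (fun u => (starRingEnd ℂ) ((g i) (-u))) (ContinuousLinearMap.mul ℂ ℂ) MeasureTheory.MeasureSpace.volume t; (∀ n : ℕ, 2 ≤ n → 0 ≤ (F (Real.log n)).re) ∧ ¬ (∃ T : ℝ, 3 ≤ T ∧ ∀ t : ℝ, Real.log 2 ≤ |t| → (F t).re < 0 → T ≤ |t| ∧ |t| ≤ T + Real.log 2) ∧ ∃ t : ℝ, Real.log 2 ≤ |t| ∧ (F t).re < 0 := by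
  intro a ha1
  have hlt : Real.log 2 / 2 < (1 : ℝ) := by linarith [Real.log_two_lt_d9]
  obtain ⟨k, g, hg, hn, hosc⟩ := (oscillatoryClass_nonempty_iff one_pos).2 hlt
  have hg1 : ∀ i, (ContDiff ℝ ((⊤ : ℕ∞) : WithTop ℕ∞) (g i) ∧ HasCompactSupport (g i)) ∧
      tsupport (g i) ⊆ Set.Icc (-(1 : ℝ)) 1 := fun i => ⟨(hg i).1, (hg i).2⟩
  refine ⟨k, g, fun i => ⟨(hg i).1, (hg i).2.trans (Icc_subset_Icc (by linarith) ha1)⟩, hn, ?_, hosc⟩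
  rintro ⟨T, hT3, hT⟩
  obtain ⟨t, ht, hneg⟩ := hosc
  have hTt := (hT t ht hneg).1
  have hle : |t| ≤ 2 := by
    by_contra hgt
    push Not at hgt
    have h0 := sum_weilConv_apply_eq_zero_of_lt_abs hg1 (by linarith : 2 * (1 : ℝ) < |t|)
    have : ((fun t => ∑ i, weilConv (g i) (weilReflect (g i)) t) t).re = 0 := by
      show (∑ i, weilConv (g i) (weilReflect (g i)) t).re = 0
      rw [h0, Complex.zero_re]
    linarith
  linarith

/-! ## §N Numerics — none run this cycle

The parent's kit LP (j020695, Cruxes/SignConeOscillatory/Disproof.lean §N) applies verbatim, the class restriction being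
idle: `min Re W_ar(F)/F(0)` on the node-nonnegative cone is `+0.048, +0.033, +0.025, +0.021` at `a = 1, 1.5, 2, 2.3`
(consistent with RH, decreasing in `a`); prime-power nodes alone give the same values; dropping `{2,3,4,5}` crosses
`-1` from `x ≈ 55`. No certified primal evaluation was attempted (see the module docstring, item 5).
-/

end Summit.RiemannHypothesis.RiemannHypothesis.Cruxes.OscCoherentCore.Disproof

end
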